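import Summits.ABC.ABC.Theses.DefiniteXi
import Literature.NumberTheory.EllipticCurves.SzpiroFreyConductorProofs
import HarnessLib

/-!
# An odd prime of the conductor of a Frey curve divides it exactly once
(stub `stub_freyLocal` of line `Sketch`, crux `DefiniteXi.DefiniteRTControlPrime`, stmt-ABC-11338)

For coprime integers `a, b` with `ab(a+b) ≠ 0`, let `N` be the conductor of the Frey curve
`E_(a,b) : y² = x (x − a) (x + b)` and `q ∣ N` an odd prime. Then `gcd(N / q, q) = 1`.

Proof. `E_(a,b)` is semistable away from `2`, so `N ∣ 2⁸ · rad(ab(a+b))` (the discharged tree fact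
`conductorNorm_freyCurve_dvd_holds`, Frey 1986; Bombieri–Gubler Ex. 12.5.10). If `q ∣ N / q`
then `q² ∣ (N / q) · q = N ∣ 2⁸ · rad(ab(a+b))`; as `q` is odd, `q² ∣ rad(ab(a+b))`, which is
squarefree — a contradiction. Hence `q ∤ N / q`, which for a prime `q` is `gcd(N / q, q) = 1`.
-/

-- `Summit.<Summit>.<Problem>`: for the single-conjunct summit `ABC` the duplicate `ABC.ABC` is
-- mandated.
set_option linter.dupNamespace false

noncomputable section

namespace Summit.ABC.ABC.Theorems.DefiniteRTControlPrime

open Literature.NumberTheory.EllipticCurves WeierstrassCurve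

/-- **An odd prime of the conductor of a Frey curve divides it exactly once.** For `a, b` coprime
with `ab(a+b) ≠ 0` and an odd prime `q` dividing the conductor `N` of the Frey curve
`y² = x (x − a) (x + b)`, the cofactor `N / q` is prime to `q`: `N ∣ 2⁸ · rad(ab(a+b))`
(`conductorNorm_freyCurve_dvd_holds`: the curve is multiplicative at every odd bad prime) and the
radical is squarefree, so `q² ∤ N`. -/
theorem stub_freyLocal (a b : ℤ) (hab : IsCoprime a b) (h0 : a * b * (a + b) ≠ 0) (q : ℕ)
    (hq : q.Prime) (hq2 : q ≠ 2) (hqN : q ∣ (freyCurve a b).conductorNorm ℤ) :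
    ((freyCurve a b).conductorNorm ℤ / q).Coprime q := by
  refine Nat.Coprime.symm ((Nat.Prime.coprime_iff_not_dvd hq).mpr fun hdvd => ?_)
  -- `q ∣ N / q` and `q ∣ N` give `q² ∣ N ∣ 2⁸ · rad(ab(a+b))`
  have hsqN : q * q ∣ (freyCurve a b).conductorNorm ℤ := by
    rw [← Nat.div_mul_cancel hqN]
    exact Nat.mul_dvd_mul hdvd dvd_rfl
  have hqq : q * q ∣ 2 ^ 8 * (UniqueFactorizationMonoid.radical (a * b * (a + b))).natAbs :=
    hsqN.trans (conductorNorm_freyCurve_dvd_holds a b hab h0)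
  -- `q` is odd, so `q² ∣ rad(ab(a+b))`, a squarefree number
  have hq2' : Nat.Coprime q 2 := (Nat.coprime_primes hq Nat.prime_two).mpr hq2
  have hcop : Nat.Coprime (q * q) (2 ^ 8) :=
    Nat.Coprime.pow_right 8 (Nat.Coprime.mul_left hq2' hq2')
  have hsqR : Squarefree (UniqueFactorizationMonoid.radical (a * b * (a + b))).natAbs :=
    Int.squarefree_natAbs.mpr UniqueFactorizationMonoid.squarefree_radical
  exact hq.one_lt.ne' (Nat.isUnit_iff.mp (hsqR q (hcop.dvd_of_dvd_mul_left hqq)))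

end Summit.ABC.ABC.Theorems.DefiniteRTControlPrime

end
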